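import Summits.Ventures.HSemireg.WedgeHankelRecurrencePeriodFinite
import Literature.Algebra.Polynomial.PrimitivePolynomialCriteria

/-!
# Venture HSemireg — MAXIMAL-PERIOD CLASSES (m-sequences): over a finite field with `q` elements, for `m` monic of degree `d ≥ 1` and a residue `a` prime to `m`,
# **the least period of the dual class `dualSeq m a` is `q^d − 1` iff `m` is PRIMITIVE** (irreducible with `x = X mod m` a primitive `(q^d − 1)`-th root of unity);
# and a dual class with a positive period has non-singular feedback (`m(0) ≠ 0`) («m-sequences ⟺ primitive connection polynomial», Lidl–Niederreiter Thm 3.16 ∕ Ch. 8)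

HONEST FRAMING. Part of the Lean index of the computation cell `pub-hsemireg` (seat p10 gen 30, Sunday typer «UNIFORM-IN-n»).
LINEAR ALGEBRA OF HANKEL (catalecticant) MATRICES and of polynomials over a field ONLY: no variety, no cohomology theory, no sheaf, no Ext group and no semiregularity map is constructed
here; nothing here says that HC / HC_CM / HC_AV holds.  No unproved named fact is used: the PROVED Literature modules `Literature.Algebra.Polynomial.OrderOfPolynomial` (`polOrd`) and
`Literature.Algebra.Polynomial.PrimitivePolynomialCriteria` (Lidl–Niederreiter Thm 3.16: `irreducible_and_isPrimitiveRoot_iff_polOrd_eq`, `coeff_zero_ne_zero_of_polOrd_eq`) are imported and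
nothing of them is restated.  Custodian versions as in `WedgeHankelSiegelIdeal` (1/3).

WHAT IS IN THE TREE.  N81 (`WedgeHankelRecurrencePeriod`): `periodic_dualSeq_iff_dvd`.  N85 (`WedgeHankelRecurrencePeriodFinite`): `isLeast_setOf_periodic_dualSeq` (least period `= polOrd m` when
`m(0) ≠ 0`).  Literature: as above.  Mathlib: `Polynomial.X_dvd_iff`, `IsLeast.unique`.
THIS FILE (namespace `Summit.Ventures.HSemireg.Wedge.HankelOuter` continued; CHAINED on N85 (+ the second Literature module); 0 definitions):
* §643 `coeff_zero_ne_zero_of_periodic_dualSeq` (any field: a positive period of `dualSeq m a`, `gcd(m, a) = 1`, forces `m(0) ≠ 0`), `eq_polOrd_of_isLeast_setOf_periodic_dualSeq` (finite field: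
  any least positive period IS `ord(m)`), **`isLeast_setOf_periodic_dualSeq_card_pow_sub_one_iff`** (finite field, `deg m ≥ 1`, `gcd(m, a) = 1`: least period `= q^d − 1` ⟺
  `Irreducible m ∧ IsPrimitiveRoot (AdjoinRoot.root m) (q^d − 1)` — m-SEQUENCES ⟺ PRIMITIVE `m`).
Nothing Ext-side.  New names only.
-/

open Module Polynomial
open scoped Matrix Polynomial

namespace Summit.Ventures.HSemireg.Wedge.HankelOuter

open Summit.Ventures.HSemireg.Wedge Summit.Ventures.HSemireg.Wedge.Hankel
open Literature.Algebra.Polynomial.OrderOfPolynomial Literature.Algebra.Polynomial.PrimitivePolynomialCriteria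

variable (K : Type*) [Field K]

/-! ## §643. Maximal-period classes -/

/-- **a positive period forces non-singular feedback**: if `dualSeq m a` (`m` monic, `gcd(m, a) = 1`) is `T`-periodic with `T > 0` then `m(0) ≠ 0` (else `X ∣ m ∣ X^T − 1`). Any field. -/
theorem coeff_zero_ne_zero_of_periodic_dualSeq {m a : K[X]} (hm : m.Monic) (hcop : IsCoprime m a) {T : ℕ} (hT : 0 < T) (hper : Function.Periodic (dualSeq K m a) T) :
    m.coeff 0 ≠ 0 := by
  intro h0
  have hX : Polynomial.X ∣ m := Polynomial.X_dvd_iff.mpr h0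
  have h1 : (Polynomial.X : K[X]) ∣ Polynomial.X ^ T - 1 := hX.trans ((periodic_dualSeq_iff_dvd K hm hcop T).mp hper)
  have h2 := Polynomial.X_dvd_iff.mp h1
  rw [Polynomial.coeff_sub, Polynomial.coeff_X_pow, if_neg (Nat.pos_iff_ne_zero.mp hT).symm, Polynomial.coeff_one_zero] at h2
  norm_num at h2

/-- over a finite field **any least positive period of `dualSeq m a` (`gcd(m, a) = 1`) is `ord(m)`**. -/
theorem eq_polOrd_of_isLeast_setOf_periodic_dualSeq [Finite K] {m a : K[X]} (hm : m.Monic) (hcop : IsCoprime m a) {n : ℕ}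
    (hn : IsLeast {T : ℕ | 0 < T ∧ Function.Periodic (dualSeq K m a) T} n) : n = polOrd m :=
  hn.unique (isLeast_setOf_periodic_dualSeq K hm hcop (coeff_zero_ne_zero_of_periodic_dualSeq K hm hcop hn.1.1 hn.1.2))

/-- **m-SEQUENCES ⟺ PRIMITIVE CONNECTION POLYNOMIAL**: over a finite field with `q` elements, for `m` monic of degree `d ≥ 1` and a residue `a` prime to `m`, the least positive period of
`dualSeq m a` is `q^d − 1` iff `m` is irreducible and `x = X mod m` is a primitive `(q^d − 1)`-th root of unity (Lidl–Niederreiter Thm 3.16 through N85's «least period `= ord(m)`»). -/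
theorem isLeast_setOf_periodic_dualSeq_card_pow_sub_one_iff [Finite K] {m a : K[X]} (hm : m.Monic) (hd : 0 < m.natDegree) (hcop : IsCoprime m a) :
    IsLeast {T : ℕ | 0 < T ∧ Function.Periodic (dualSeq K m a) T} (Nat.card K ^ m.natDegree - 1) ↔
      Irreducible m ∧ IsPrimitiveRoot (AdjoinRoot.root m) (Nat.card K ^ m.natDegree - 1) := by
  rw [irreducible_and_isPrimitiveRoot_iff_polOrd_eq hd]
  constructor
  · intro h
    exact (eq_polOrd_of_isLeast_setOf_periodic_dualSeq K hm hcop h).symm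
  · intro h
    rw [← h]
    exact isLeast_setOf_periodic_dualSeq K hm hcop (coeff_zero_ne_zero_of_polOrd_eq hd h)

end Summit.Ventures.HSemireg.Wedge.HankelOuter
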